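/-
Copyright: derived here (Resolution Observatory cell `pub-rosobs`, carver gen 50). AI-written Lean; AI review is
weaker than expert review.  Companion file of the cell's POLYNOMIAL weighted-centre model `W(f)`: the identity core
of engine 1's LEMMA Λ₄ (a) "radical isotropy" (THEOREM-FQ-eng1-g34 §13; CARVER-NOTES-eng1-g34 T18 (a)) and of the
cubic Euler step (CARVER-NOTES-eng1-g33 T11 (i)).  Instrument — NOT a resolution theorem and NOT a statement about
the invariant of [AbramovichTemkinWlodarczyk2024].
-/
import Mathlib.RingTheory.MvPolynomial.EulerIdentity
import HarnessLib

/-!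
# Radical isotropy: a form of degree `n` (`n` invertible) vanishes on the span of its radical directions

Setting: `K` a commutative ring, `φ ∈ K[X_σ]` (`σ` finite) homogeneous of degree `n` with `n` a unit of `K`
(quadratic forms in characteristic `≠ 2`, cubic forms in characteristic `≠ 3`), and constant vectors
`g_i ∈ K^σ` (`i ∈ s`) that are RADICAL DIRECTIONS of `φ`: the directional derivative `D_{g_i} φ = Σ_k (g_i)_k ∂_k φ`
vanishes identically (for a quadratic form `Q` with polar form `B` this says `g_i ∈ rad B`, since
`D_g Q (x) = B(g, x)`).

* `aeval_eq_zero_of_directional_pderiv_eq_zero` (**Λ₄ (a), radical isotropy / polarisation**; T18 (a)): for every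
  commutative `K`-algebra `A` and all `λ_i ∈ A` — scalars or indeterminates — `φ(Σ_i λ_i g_i) = 0`.
  Proof: evaluate Euler's identity `Σ_k X_k ∂_k φ = n·φ` (Mathlib `IsHomogeneous.sum_X_mul_pderiv`) at
  `y = Σ_i λ_i g_i`: `n·φ(y) = Σ_i λ_i (D_{g_i} φ)(y) = 0`, and `n` is invertible.
* `eval_eq_zero_of_directional_pderiv_eq_zero` (T11 (i), "cubic Euler step"): one direction, scalars:
  `D_g φ ≡ 0 ⇒ φ(g) = 0`.

Not here: the companion statement "`D_g φ ≡ 0`, `deg φ < p` ⇒ after the line substitution `e_{k₀} ↦ g` the form is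
free of `X_{k₀}`" — that is `notMem_vars_lineSubst_of_kernel` of `WeightedCentreOneRound` (covers T10, T11 (ii), T17).

[ATW24] Abramovich–Temkin–Włodarczyk, Algebra & Number Theory 18 (2024), §5.2 (pp. 1576–1577).  CONTEXT ONLY
(coordinate changes preserving the centre); the identities are classical (Euler) and the formalisation is ours.
-/

namespace Literature.AlgebraicGeometry.Resolution.WeightedBlowup

open MvPolynomial

variable {K : Type*} [CommRing K] {σ : Type*} [Fintype σ]

/-- **Radical isotropy (Λ₄ (a); polarisation).**  If `φ` is homogeneous of degree `n`, `n` is a unit of `K`, and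
the constant vectors `g_i` (`i ∈ s`) satisfy `Σ_k (g_i)_k ∂_k φ = 0`, then `φ(Σ_{i ∈ s} λ_i g_i) = 0` for all `λ_i`
in any commutative `K`-algebra `A` (derived here from Euler's identity).
[cite: AbramovichTemkinWlodarczyk2024, §5.2 (pp. 1576–1577)] -/
theorem aeval_eq_zero_of_directional_pderiv_eq_zero {φ : MvPolynomial σ K} {n : ℕ} (hφ : φ.IsHomogeneous n)
    (hn : IsUnit (n : K)) {A : Type*} [CommRing A] [Algebra K A] {ι : Type*} (s : Finset ι) (g : ι → σ → K)
    (hg : ∀ i ∈ s, ∑ k, g i k • pderiv k φ = 0) (lam : ι → A) :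
    aeval (fun k => ∑ i ∈ s, lam i * algebraMap K A (g i k)) φ = 0 := by
  set y : σ → A := fun k => ∑ i ∈ s, lam i * algebraMap K A (g i k) with hy
  have euler := congrArg (aeval y) hφ.sum_X_mul_pderiv
  rw [map_sum, map_nsmul] at euler
  simp_rw [map_mul, aeval_X] at euler
  -- `Σ_k y_k · (∂_k φ)(y) = Σ_i λ_i · (D_{g_i} φ)(y) = 0`
  have h1 : ∀ i ∈ s, lam i * aeval y (∑ k, g i k • pderiv k φ)
      = ∑ k, lam i * algebraMap K A (g i k) * aeval y (pderiv k φ) := by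
    intro i _
    rw [map_sum, Finset.mul_sum]
    refine Finset.sum_congr rfl fun k _ => ?_
    rw [map_smul, Algebra.smul_def, mul_assoc]
  have hzero : ∑ k, y k * aeval y (pderiv k φ) = 0 :=
    calc ∑ k, y k * aeval y (pderiv k φ)
        = ∑ k, ∑ i ∈ s, lam i * algebraMap K A (g i k) * aeval y (pderiv k φ) :=
          Finset.sum_congr rfl fun k _ => Finset.sum_mul _ _ _
      _ = ∑ i ∈ s, ∑ k, lam i * algebraMap K A (g i k) * aeval y (pderiv k φ) := Finset.sum_comm
      _ = ∑ i ∈ s, lam i * aeval y (∑ k, g i k • pderiv k φ) :=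
          Finset.sum_congr rfl fun i hi => (h1 i hi).symm
      _ = 0 := Finset.sum_eq_zero fun i hi => by rw [hg i hi, map_zero, mul_zero]
  rw [hzero] at euler
  have key : (n : K) • aeval y φ = 0 := by rw [Nat.cast_smul_eq_nsmul]; exact euler.symm
  obtain ⟨u, hu⟩ := hn
  calc aeval y φ = ((↑u⁻¹ : K) * (n : K)) • aeval y φ := by rw [← hu, Units.inv_mul, one_smul]
    _ = (↑u⁻¹ : K) • ((n : K) • aeval y φ) := mul_smul _ _ _
    _ = 0 := by rw [key, smul_zero]

/-- **One radical direction, scalars** (T11 (i), "cubic Euler step": `D_g C ≡ 0 ⇒ C(g) = 0` for a cubic `C` in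
characteristic `≠ 3`; likewise `Q(g) = 0` for `g ∈ rad B`, `char ≠ 2`): if `φ` is homogeneous of degree `n`, `n` a
unit of `K`, and `Σ_k g_k ∂_k φ = 0`, then `φ(g) = 0` (derived here).
[cite: AbramovichTemkinWlodarczyk2024, §5.2 (pp. 1576–1577)] -/
theorem eval_eq_zero_of_directional_pderiv_eq_zero {φ : MvPolynomial σ K} {n : ℕ} (hφ : φ.IsHomogeneous n)
    (hn : IsUnit (n : K)) (g : σ → K) (hg : ∑ k, g k • pderiv k φ = 0) : eval g φ = 0 := by
  have h := aeval_eq_zero_of_directional_pderiv_eq_zero hφ hn (A := K) ({()} : Finset Unit) (fun _ => g)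
    (fun _ _ => hg) (fun _ => 1)
  have h' : aeval g φ = 0 := by simpa only [Finset.sum_singleton, one_mul, Algebra.algebraMap_self_apply] using h
  rwa [aeval_eq_eval] at h'

/-- **Radical isotropy along a line of indeterminate slope** (the form used by Λ₄: `Q(ε + λ g)`-type substitutions
are made with `λ` an indeterminate): for ONE radical direction `g` and any element `t` of a commutative `K`-algebra
(e.g. a variable of a polynomial ring), `φ(t·g) = 0` (derived here).
[cite: AbramovichTemkinWlodarczyk2024, §5.2 (pp. 1576–1577)] -/
theorem aeval_smul_eq_zero_of_directional_pderiv_eq_zero {φ : MvPolynomial σ K} {n : ℕ}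
    (hφ : φ.IsHomogeneous n) (hn : IsUnit (n : K)) {A : Type*} [CommRing A] [Algebra K A] (g : σ → K)
    (hg : ∑ k, g k • pderiv k φ = 0) (t : A) : aeval (fun k => t * algebraMap K A (g k)) φ = 0 := by
  have h := aeval_eq_zero_of_directional_pderiv_eq_zero hφ hn (A := A) ({()} : Finset Unit) (fun _ => g)
    (fun _ _ => hg) (fun _ => t)
  simpa only [Finset.sum_singleton] using h

end Literature.AlgebraicGeometry.Resolution.WeightedBlowup
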